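import Summits.CriticalPhenomena.CardyFormulaZ2.Theorems.CardyComplexConeDefs

/-!
# Stub `stub_pairingBound` of line `finitary-green-pairing`
(crux `CoherentMorera`, stmt-CriticalPhenomena-11388)

Deterministic summation by parts (no probability). For a test function `φ ∈ C_c^∞(U)` and a corner
function `G` bounded by `M` obeying the chirality-`+i` vertex relation `KirchhoffRel G x i` at every
lattice edge `s(x, x + eᵢ)` whose medial point lies in `U`, the two site pairings satisfy
`‖pair0 G φ δ − i · pair2 G φ δ‖ ≤ C · M / δ` for `0 < δ ≤ 1`, with `C = 4 (2R + 5)² M₂` where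
`tsupport φ ⊆ closedBall 0 R` and `M₂` bounds the second derivative of `φ`.

Proof.
1. *Green identity* (`green_identity`). Multiply the relation at the edge `z` by `φ(m_z)` (`m_z` the
   medial point) and sum over all edges: wherever `φ(m_z) ≠ 0` we have `m_z ∈ tsupport φ ⊆ U`, so
   every summand vanishes. Regrouped by corners `(v, f)` (each corner sits at two edges; the
   regrouping is a lattice translation of two of the four partial sums, done with
   `finsum_comp_equiv`) this reads `Σ_v E(v) = 0`, where `E(v)` collects, for the four corner
   classes at `v`, `G` times a difference of two values of `φ` at the midpoints `δv ± δ/2`,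
   `δv ± iδ/2`.
2. *Linearisation* (`corner_linearisation_eq`, `norm_corner_taylor_le`). Replacing each midpoint
   difference by the differential of `φ` at `δv` costs `≤ 8 M M₂ (δ/2)²` per site (second-order
   Taylor estimate `taylor_two`, from the mean value inequality), and the linearised sum is exactly
   `(δ/2)(1+i) Σ_v (A₀(v) ∂̄φ(δv) − i A₂(v) ∂φ(δv)) = (δ/2)(1+i)(pair0 − i·pair2)`.
3. *Counting* (`card_box_le`, `mem_box`). Only the `≤ (2R+5)²/δ²` sites of a box contribute, whence
   `(δ/2)‖pair0 − i pair2‖ ≤ (2R+5)² δ⁻² · 8 M M₂ (δ/2)²`, i.e. the claim.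
-/

namespace Summit.CriticalPhenomena.CardyFormulaZ2.Cruxes.CoherentMorera.FinitaryGreenPairing

open MeasureTheory Filter Set Metric Complex
open scoped Topology BigOperators
open Literature.Probability.LatticeModels

noncomputable section

/-! ## A second-order Taylor estimate -/

/-- For a `C^∞` function `g : ℂ → ℂ` of compact support there is `M₂ ≥ 0` with
`‖g (p + u) - g p - Dg(p)[u]‖ ≤ M₂ ‖u‖²` for all `p, u` (mean value inequality for `g - Dg(p)` on
the ball of radius `‖u‖` about `p`, the differential `Dg` being `C¹` of compact support, hence
globally `M₂`-Lipschitz). -/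
theorem taylor_two {g : ℂ → ℂ} (hg : ContDiff ℝ (⊤ : ℕ∞) g) (hc : HasCompactSupport g) :
    ∃ M₂ : ℝ, 0 ≤ M₂ ∧ ∀ p u : ℂ, ‖g (p + u) - g p - fderiv ℝ g p u‖ ≤ M₂ * ‖u‖ ^ 2 := by
  have h2 : ContDiff ℝ 2 g := contDiff_infty.mp hg 2
  have h1 : ContDiff ℝ 1 (fderiv ℝ g) := h2.fderiv_right (by norm_num)
  obtain ⟨C, hC⟩ := h1.lipschitzWith_of_hasCompactSupport (hc.fderiv ℝ) one_ne_zero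
  have hd : Differentiable ℝ g := h2.differentiable (by norm_num)
  refine ⟨C, C.coe_nonneg, fun p u => ?_⟩
  have key := (convex_closedBall p ‖u‖).norm_image_sub_le_of_norm_fderiv_le'
    (fun x _ => hd x) (fun z hz => (hC.norm_sub_le z p).trans
      (mul_le_mul_of_nonneg_left (mem_closedBall_iff_norm.mp hz) C.coe_nonneg))
    (mem_closedBall_self (norm_nonneg u))
    (show p + u ∈ closedBall p ‖u‖ from
      mem_closedBall_iff_norm.mpr (le_of_eq (by rw [add_sub_cancel_left])))
  rw [add_sub_cancel_left] at key
  calc ‖g (p + u) - g p - fderiv ℝ g p u‖ ≤ C * ‖u‖ * ‖u‖ := key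
    _ = C * ‖u‖ ^ 2 := by ring

/-- A real-linear map `ℂ → ℂ` commutes with multiplication by a real scalar written as a complex
number. -/
theorem clm_apply_ofReal_mul (L : ℂ →L[ℝ] ℂ) (h : ℝ) (z : ℂ) :
    L ((h : ℂ) * z) = (h : ℂ) * L z := by
  have := L.map_smul h z
  simpa only [real_smul] using this

/-! ## The per-site linearisation and its second-order error -/

/-- The linearised corner sum at a site is `η(1+i)·(A₀(v) ∂̄φ(q) − i A₂(v) ∂φ(q))`: with
`a = Dφ(q)[1]`, `b = Dφ(q)[i]`, classes `0, −e₀−e₁` carry `a − b` and classes `−e₀, −e₁` carry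
`i(a + b)`. -/
theorem corner_linearisation_eq (G : Site 2 × Site 2 → ℂ) (φ : ℂ → ℂ) (v : Site 2) (q η : ℂ) :
    η * ((G (v, v) + G (v, v - e0 - e1)) * (fderiv ℝ φ q 1 - fderiv ℝ φ q I)
      + I * (G (v, v - e0) + G (v, v - e1)) * (fderiv ℝ φ q 1 + fderiv ℝ φ q I))
    = η * (1 + I) * (A0 G v * dbar φ q - I * (A2 G v * del φ q)) := by
  simp only [A0, A2, dbar, del]
  linear_combination (-(η / 2) *
    ((2 * (G (v, v) + G (v, v - e0 - e1)) * fderiv ℝ φ q I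
      - (G (v, v) + G (v, v - e0 - e1)) * fderiv ℝ φ q 1
      + (G (v, v - e0) + G (v, v - e1)) * fderiv ℝ φ q 1)
      + I * ((G (v, v) + G (v, v - e0 - e1)) * fderiv ℝ φ q I
      - (G (v, v - e0) + G (v, v - e1)) * fderiv ℝ φ q I))) * I_mul_I

/-- Second-order error of the linearisation at one site: if the corner values `gₖ` are bounded by
`M` and `φ` obeys the Taylor estimate with constant `M₂` at `p`, the four corner terms built on the
midpoints `p ± h`, `p ± ih` differ from their linearisation by at most `8 M M₂ h²`. -/
theorem norm_corner_taylor_le {φ : ℂ → ℂ} {M₂ M : ℝ} (h : ℝ) (hM : 0 ≤ M) {p : ℂ}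
    (hT : ∀ u : ℂ, ‖φ (p + u) - φ p - fderiv ℝ φ p u‖ ≤ M₂ * ‖u‖ ^ 2)
    {g₀ g₁ g₂ g₃ : ℂ} (n₀ : ‖g₀‖ ≤ M) (n₁ : ‖g₁‖ ≤ M) (n₂ : ‖g₂‖ ≤ M) (n₃ : ‖g₃‖ ≤ M) :
    ‖(g₀ * (φ (p + h) - φ (p + h * I)) + I * g₁ * (φ (p + h * I) - φ (p - h))
        + g₂ * (φ (p - h * I) - φ (p - h)) + I * g₃ * (φ (p + h) - φ (p - h * I)))
      - h * ((g₀ + g₂) * (fderiv ℝ φ p 1 - fderiv ℝ φ p I)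
        + I * (g₁ + g₃) * (fderiv ℝ φ p 1 + fderiv ℝ φ p I))‖ ≤ 8 * M * M₂ * h ^ 2 := by
  have eR : fderiv ℝ φ p (h : ℂ) = h * fderiv ℝ φ p 1 := by
    simpa using clm_apply_ofReal_mul (fderiv ℝ φ p) h 1
  have eU : fderiv ℝ φ p ((h : ℂ) * I) = h * fderiv ℝ φ p I :=
    clm_apply_ofReal_mul (fderiv ℝ φ p) h I
  have nh : ‖(h : ℂ)‖ ^ 2 = h ^ 2 := by rw [norm_real, Real.norm_eq_abs, sq_abs]
  have nhI : ‖(h : ℂ) * I‖ ^ 2 = h ^ 2 := by rw [norm_mul, norm_I, mul_one, nh]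
  have TR : ‖φ (p + h) - φ p - h * fderiv ℝ φ p 1‖ ≤ M₂ * h ^ 2 := by
    have := hT h; rwa [eR, nh] at this
  have TU : ‖φ (p + h * I) - φ p - h * fderiv ℝ φ p I‖ ≤ M₂ * h ^ 2 := by
    have := hT (h * I); rwa [eU, nhI] at this
  have TL : ‖φ (p - h) - φ p + h * fderiv ℝ φ p 1‖ ≤ M₂ * h ^ 2 := by
    have := hT (-h); rwa [map_neg, eR, ← sub_eq_add_neg, sub_neg_eq_add, norm_neg, nh] at this
  have TD : ‖φ (p - h * I) - φ p + h * fderiv ℝ φ p I‖ ≤ M₂ * h ^ 2 := by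
    have := hT (-(h * I))
    rwa [map_neg, eU, ← sub_eq_add_neg, sub_neg_eq_add, norm_neg, nhI] at this
  have key : ∀ g t₁ t₂ : ℂ, ‖g‖ ≤ M → ‖t₁‖ ≤ M₂ * h ^ 2 → ‖t₂‖ ≤ M₂ * h ^ 2 →
      ‖g * (t₁ - t₂)‖ ≤ M * (2 * M₂ * h ^ 2) := by
    intro g t₁ t₂ hg h₁ h₂
    rw [norm_mul]
    exact mul_le_mul hg ((norm_sub_le _ _).trans (by linarith)) (norm_nonneg _) hM
  have nIg : ∀ g : ℂ, ‖g‖ ≤ M → ‖I * g‖ ≤ M := fun g hg => by rwa [norm_mul, norm_I, one_mul]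
  have A := key g₀ _ _ n₀ TR TU
  have B := key (I * g₁) _ _ (nIg g₁ n₁) TU TL
  have C := key g₂ _ _ n₂ TD TL
  have D := key (I * g₃) _ _ (nIg g₃ n₃) TR TD
  calc _ = ‖g₀ * ((φ (p + h) - φ p - h * fderiv ℝ φ p 1)
          - (φ (p + h * I) - φ p - h * fderiv ℝ φ p I))
        + I * g₁ * ((φ (p + h * I) - φ p - h * fderiv ℝ φ p I)
          - (φ (p - h) - φ p + h * fderiv ℝ φ p 1))
        + g₂ * ((φ (p - h * I) - φ p + h * fderiv ℝ φ p I)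
          - (φ (p - h) - φ p + h * fderiv ℝ φ p 1))
        + I * g₃ * ((φ (p + h) - φ p - h * fderiv ℝ φ p 1)
          - (φ (p - h * I) - φ p + h * fderiv ℝ φ p I))‖ := by ring_nf
    _ ≤ M * (2 * M₂ * h ^ 2) + M * (2 * M₂ * h ^ 2) + M * (2 * M₂ * h ^ 2)
        + M * (2 * M₂ * h ^ 2) :=
        norm_add_le_of_le (norm_add_le_of_le (norm_add_le_of_le A B) C) D
    _ = 8 * M * M₂ * h ^ 2 := by ring

/-! ## Lattice bookkeeping -/

/-- `δ(x + e₀) = δx + δ`. -/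
theorem meshPoint_add_e0 (δ : ℝ) (x : Site 2) : meshPoint δ (x + e0) = meshPoint δ x + δ := by
  apply Complex.ext
  · simp [mul_add]
  · simp

/-- `δ(x + e₁) = δx + iδ`. -/
theorem meshPoint_add_e1 (δ : ℝ) (x : Site 2) : meshPoint δ (x + e1) = meshPoint δ x + δ * I := by
  apply Complex.ext
  · simp
  · simp [mul_add]

/-- The medial point of the horizontal edge at `x` is `δx + δ/2`. -/
theorem medialPoint_horizontal (δ : ℝ) (x : Site 2) :
    medialPoint δ s(x, x + Pi.single 0 1) = meshPoint δ x + ((δ / 2 : ℝ) : ℂ) := by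
  apply Complex.ext
  · simp; ring
  · simp

/-- The medial point of the vertical edge at `x` is `δx + iδ/2`. -/
theorem medialPoint_vertical (δ : ℝ) (x : Site 2) :
    medialPoint δ s(x, x + Pi.single 1 1) = meshPoint δ x + ((δ / 2 : ℝ) : ℂ) * I := by
  apply Complex.ext
  · simp
  · simp; ring

/-- The box of sites with both coordinates in `[-N, N]` has at most `(2N+1)²` sites. -/
theorem card_box_le (N : ℕ) :
    (((Finset.Icc (-(N : ℤ)) N) ×ˢ (Finset.Icc (-(N : ℤ)) N)).image
      (fun q : ℤ × ℤ => (![q.1, q.2] : Site 2))).card ≤ (2 * N + 1) ^ 2 := by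
  refine Finset.card_image_le.trans ?_
  rw [Finset.card_product, Int.card_Icc]
  have : (N + 1 - -(N : ℤ)).toNat = 2 * N + 1 := by omega
  rw [this]; ring_nf; exact le_rfl

/-- Sites with both coordinates in `[-N, N]` lie in the box. -/
theorem mem_box {N : ℕ} {v : Site 2} (h0 : |v 0| ≤ N) (h1 : |v 1| ≤ N) :
    v ∈ ((Finset.Icc (-(N : ℤ)) N) ×ˢ (Finset.Icc (-(N : ℤ)) N)).image
      (fun q : ℤ × ℤ => (![q.1, q.2] : Site 2)) := by
  rw [Finset.mem_image]
  obtain ⟨h0l, h0r⟩ := abs_le.mp h0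
  obtain ⟨h1l, h1r⟩ := abs_le.mp h1
  refine ⟨(v 0, v 1), ?_, ?_⟩
  · simp only [Finset.mem_product, Finset.mem_Icc]
    exact ⟨⟨h0l, h0r⟩, h1l, h1r⟩
  · funext i; fin_cases i <;> rfl

/-! ## The discrete Green identity -/

/-- Summation by parts: if `G` obeys `KirchhoffRel` at every lattice edge whose medial point lies in
`U ⊇ tsupport φ`, then `Σ_{v ∈ B} E(v) = 0` for every finite set of sites `B` containing all sites
`v` with `φ ≠ 0` at one of the four midpoints `δv ± δ/2`, `δv ± iδ/2`. Here the summand `E(v)`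
collects for the four corner classes at `v` the value of `G` times a difference of two values of
`φ`: class `0` (`f = v`) carries `φ(δv + δ/2) − φ(δv + iδ/2)`, class `−e₀` carries
`i(φ(δv + iδ/2) − φ(δv − δ/2))`, class `−e₀−e₁` carries `φ(δv − iδ/2) − φ(δv − δ/2)` and class `−e₁`
carries `i(φ(δv + δ/2) − φ(δv − iδ/2))`. -/
theorem green_identity {φ : ℂ → ℂ} {U : Set ℂ} (hφU : tsupport φ ⊆ U) {δ : ℝ}
    {G : Site 2 × Site 2 → ℂ}
    (hK : ∀ (x : Site 2) (i : Fin 2), medialPoint δ s(x, x + Pi.single i 1) ∈ U →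
      KirchhoffRel G x i)
    {B : Finset (Site 2)}
    (hR : ∀ v, φ (meshPoint δ v + (δ / 2 : ℝ)) ≠ 0 → v ∈ B)
    (hL : ∀ v, φ (meshPoint δ v - (δ / 2 : ℝ)) ≠ 0 → v ∈ B)
    (hU : ∀ v, φ (meshPoint δ v + (δ / 2 : ℝ) * I) ≠ 0 → v ∈ B)
    (hD : ∀ v, φ (meshPoint δ v - (δ / 2 : ℝ) * I) ≠ 0 → v ∈ B) :
    ∑ v ∈ B, (G (v, v) * (φ (meshPoint δ v + (δ / 2 : ℝ)) - φ (meshPoint δ v + (δ / 2 : ℝ) * I))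
      + I * G (v, v - e0) * (φ (meshPoint δ v + (δ / 2 : ℝ) * I) - φ (meshPoint δ v - (δ / 2 : ℝ)))
      + G (v, v - e0 - e1) * (φ (meshPoint δ v - (δ / 2 : ℝ) * I) - φ (meshPoint δ v - (δ / 2 : ℝ)))
      + I * G (v, v - e1) * (φ (meshPoint δ v + (δ / 2 : ℝ)) - φ (meshPoint δ v - (δ / 2 : ℝ) * I)))
      = 0 := by
  set η : ℂ := ((δ / 2 : ℝ) : ℂ) with hη
  have hpe0 : ∀ x, meshPoint δ (x + e0) - η = meshPoint δ x + η := by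
    intro x; rw [meshPoint_add_e0, hη]; push_cast; ring
  have hpe1 : ∀ x, meshPoint δ (x + e1) - η * I = meshPoint δ x + η * I := by
    intro x; rw [meshPoint_add_e1, hη]; push_cast; ring
  -- the two partial sums to be translated
  set β : Site 2 → ℂ := fun v =>
    φ (meshPoint δ v - η) * (I * G (v, v - e0) + G (v, v - e0 - e1)) with hβ
  set κ : Site 2 → ℂ := fun v =>
    φ (meshPoint δ v - η * I) * (G (v, v - e0 - e1) - I * G (v, v - e1)) with hκ
  have sβ : Function.support β ⊆ ↑B := by
    intro v hv
    refine hL v fun h0 => hv ?_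
    simp only [hβ, h0, zero_mul]
  have sβ' : Function.support (fun x => β (x + e0)) ⊆ ↑B := by
    intro x hx
    refine hR x fun h0 => hx ?_
    simp only [hβ, hpe0, h0, zero_mul]
  have sκ : Function.support κ ⊆ ↑B := by
    intro v hv
    refine hD v fun h0 => hv ?_
    simp only [hκ, h0, zero_mul]
  have sκ' : Function.support (fun x => κ (x + e1)) ⊆ ↑B := by
    intro x hx
    refine hU x fun h0 => hx ?_
    simp only [hκ, hpe1, h0, zero_mul]
  have hβs : ∑ v ∈ B, β v = ∑ x ∈ B, β (x + e0) := by
    rw [← finsum_eq_sum_of_support_subset _ sβ, ← finsum_eq_sum_of_support_subset _ sβ']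
    exact (finsum_comp_equiv (Equiv.addRight e0)).symm
  have hκs : ∑ v ∈ B, κ v = ∑ x ∈ B, κ (x + e1) := by
    rw [← finsum_eq_sum_of_support_subset _ sκ, ← finsum_eq_sum_of_support_subset _ sκ']
    exact (finsum_comp_equiv (Equiv.addRight e1)).symm
  -- at each edge, the regrouped summand is `φ(midpoint) · (Kirchhoff relation)`
  have hA : ∀ x ∈ B, φ (meshPoint δ x + η) * (G (x, x) + I * G (x, x - e1)) - β (x + e0) = 0 := by
    intro x _
    by_cases h0 : φ (meshPoint δ x + η) = 0
    · simp only [hβ, hpe0, h0, zero_mul, sub_zero]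
    · have hm : medialPoint δ s(x, x + Pi.single 0 1) ∈ U := by
        rw [medialPoint_horizontal]
        exact hφU (subset_tsupport _ (Function.mem_support.mpr h0))
      have hk : G (x, x) - G (x + Pi.single 0 1, x - Pi.single 1 1) =
          I * (G (x + Pi.single 0 1, x) - G (x, x - Pi.single 1 1)) := hK x 0 hm
      simp only [hβ, hpe0]
      rw [add_sub_cancel_right]
      linear_combination φ (meshPoint δ x + η) * hk
  have hC : ∀ x ∈ B,
      φ (meshPoint δ x + η * I) * (-G (x, x) + I * G (x, x - e0)) + κ (x + e1) = 0 := by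
    intro x _
    by_cases h0 : φ (meshPoint δ x + η * I) = 0
    · simp only [hκ, hpe1, h0, zero_mul, add_zero]
    · have hm : medialPoint δ s(x, x + Pi.single 1 1) ∈ U := by
        rw [medialPoint_vertical]
        exact hφU (subset_tsupport _ (Function.mem_support.mpr h0))
      have hk : G (x + Pi.single 1 1, x - Pi.single 0 1) - G (x, x) =
          I * (G (x + Pi.single 1 1, x) - G (x, x - Pi.single 0 1)) := hK x 1 hm
      simp only [hκ, hpe1]
      rw [show x + e1 - e0 - e1 = x - e0 by abel, add_sub_cancel_right]
      linear_combination φ (meshPoint δ x + η * I) * hk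
  calc _ = ∑ v ∈ B, ((φ (meshPoint δ v + η) * (G (v, v) + I * G (v, v - e1)) - β v)
          + (φ (meshPoint δ v + η * I) * (-G (v, v) + I * G (v, v - e0)) + κ v)) :=
        Finset.sum_congr rfl fun v _ => by simp only [hβ, hκ, hη]; ring
    _ = (∑ v ∈ B, φ (meshPoint δ v + η) * (G (v, v) + I * G (v, v - e1)) - ∑ v ∈ B, β v)
          + (∑ v ∈ B, φ (meshPoint δ v + η * I) * (-G (v, v) + I * G (v, v - e0))
            + ∑ v ∈ B, κ v) := by
        rw [Finset.sum_add_distrib, Finset.sum_sub_distrib, Finset.sum_add_distrib]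
    _ = ∑ x ∈ B, (φ (meshPoint δ x + η) * (G (x, x) + I * G (x, x - e1)) - β (x + e0))
          + ∑ x ∈ B, (φ (meshPoint δ x + η * I) * (-G (x, x) + I * G (x, x - e0))
            + κ (x + e1)) := by
        rw [hβs, hκs, Finset.sum_sub_distrib, Finset.sum_add_distrib]
    _ = 0 := by rw [Finset.sum_eq_zero hA, Finset.sum_eq_zero hC, add_zero]

/-! ## The stub -/

/-- STUB `stub_pairingBound` (summation by parts): for `φ ∈ C_c^∞` with `tsupport φ ⊆ U` open
there are `C, δ₀ > 0` such that every corner function `G` bounded by `M` and obeying `KirchhoffRel`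
at the lattice edges with medial point in `U` has `‖pair0 G φ δ − i·pair2 G φ δ‖ ≤ C·M/δ` for
`0 < δ ≤ δ₀`. -/
theorem stub_pairingBound : Sig.stub_pairingBound := by
  intro U _hU φ hφ hc hφU
  obtain ⟨M₂, hM₂, hT⟩ := taylor_two hφ hc
  obtain ⟨R, hRpos, hR⟩ := hc.isCompact.isBounded.exists_pos_norm_le
  refine ⟨4 * (2 * R + 5) ^ 2 * M₂, 1, one_pos, fun δ hδ hδ1 G M hM hG hK => ?_⟩
  -- the box of contributing sites
  set N : ℕ := ⌈(R + 1) / δ⌉₊ with hN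
  have hNge : (R + 1) / δ ≤ N := Nat.le_ceil _
  have hNlt : (N : ℝ) < (R + 1) / δ + 1 := Nat.ceil_lt_add_one (by positivity)
  set B : Finset (Site 2) := ((Finset.Icc (-(N : ℤ)) N) ×ˢ (Finset.Icc (-(N : ℤ)) N)).image
    (fun q : ℤ × ℤ => (![q.1, q.2] : Site 2)) with hB
  have hmem : ∀ (v : Site 2) (w : ℂ), ‖w‖ ≤ 1 → meshPoint δ v + w ∈ tsupport φ → v ∈ B := by
    intro v w hw hvw
    have h1 : ‖meshPoint δ v‖ ≤ R + 1 := by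
      calc ‖meshPoint δ v‖ = ‖(meshPoint δ v + w) - w‖ := by rw [add_sub_cancel_right]
        _ ≤ ‖meshPoint δ v + w‖ + ‖w‖ := norm_sub_le _ _
        _ ≤ R + 1 := add_le_add (hR _ hvw) hw
    have hcoord : ∀ c : ℤ, |δ * c| ≤ R + 1 → |c| ≤ (N : ℤ) := by
      intro c hcδ
      rw [abs_mul, abs_of_pos hδ] at hcδ
      have : (|c| : ℝ) ≤ N := by
        refine le_trans ?_ hNge
        rw [le_div_iff₀ hδ, mul_comm]
        exact hcδ
      exact_mod_cast this
    apply mem_box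
    · exact hcoord _ (le_trans (by rw [← meshPoint_re]; exact abs_re_le_norm _) h1)
    · exact hcoord _ (le_trans (by rw [← meshPoint_im]; exact abs_im_le_norm _) h1)
  have hcard : (B.card : ℝ) * δ ^ 2 ≤ (2 * R + 5) ^ 2 := by
    have h1 : (B.card : ℝ) ≤ (2 * N + 1) ^ 2 := by exact_mod_cast card_box_le N
    have h2 : (N : ℝ) * δ < R + 1 + δ := by
      have := mul_lt_mul_of_pos_right hNlt hδ
      rwa [add_mul, div_mul_cancel₀ _ hδ.ne', one_mul] at this
    have h3 : (2 * (N : ℝ) + 1) * δ ≤ 2 * R + 5 := by nlinarith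
    have h4 : 0 ≤ (2 * (N : ℝ) + 1) * δ := by positivity
    calc (B.card : ℝ) * δ ^ 2 ≤ (2 * N + 1) ^ 2 * δ ^ 2 := by gcongr
      _ = ((2 * (N : ℝ) + 1) * δ) ^ 2 := by ring
      _ ≤ (2 * R + 5) ^ 2 := by gcongr
  -- the four midpoint offsets have norm `≤ 1`
  set η : ℝ := δ / 2 with hη
  have hηpos : 0 < η := by positivity
  have nη : ‖(η : ℂ)‖ ≤ 1 := by
    rw [norm_real, Real.norm_eq_abs, abs_of_pos hηpos]; linarith
  have nηI : ‖(η : ℂ) * I‖ ≤ 1 := by rwa [norm_mul, norm_I, mul_one]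
  have hsupp : ∀ (v : Site 2) (w : ℂ), ‖w‖ ≤ 1 → φ (meshPoint δ v + w) ≠ 0 → v ∈ B :=
    fun v w hw h0 => hmem v w hw (subset_tsupport _ (Function.mem_support.mpr h0))
  -- the per-site summand `E` of the Green identity and its linearisation `L`
  obtain ⟨E, hE⟩ : ∃ E : Site 2 → ℂ, ∀ v, E v =
      G (v, v) * (φ (meshPoint δ v + η) - φ (meshPoint δ v + η * I))
      + I * G (v, v - e0) * (φ (meshPoint δ v + η * I) - φ (meshPoint δ v - η))
      + G (v, v - e0 - e1) * (φ (meshPoint δ v - η * I) - φ (meshPoint δ v - η))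
      + I * G (v, v - e1) * (φ (meshPoint δ v + η) - φ (meshPoint δ v - η * I)) := ⟨_, fun _ => rfl⟩
  obtain ⟨L, hL⟩ : ∃ L : Site 2 → ℂ, ∀ v, L v = (η : ℂ) * ((G (v, v) + G (v, v - e0 - e1))
      * (fderiv ℝ φ (meshPoint δ v) 1 - fderiv ℝ φ (meshPoint δ v) I)
      + I * (G (v, v - e0) + G (v, v - e1))
      * (fderiv ℝ φ (meshPoint δ v) 1 + fderiv ℝ φ (meshPoint δ v) I)) := ⟨_, fun _ => rfl⟩
  -- Green identity on the box
  have hgreen : ∑ v ∈ B, E v = 0 := by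
    simp only [hE]
    refine green_identity hφU hK (fun v h0 => hsupp v _ nη h0) (fun v h0 => ?_)
      (fun v h0 => hsupp v _ nηI h0) (fun v h0 => ?_)
    · exact hsupp v (-(η : ℂ)) (by rwa [norm_neg]) (by rwa [← sub_eq_add_neg])
    · exact hsupp v (-((η : ℂ) * I)) (by rwa [norm_neg]) (by rwa [← sub_eq_add_neg])
  -- the pairings are finite sums over the box
  have hdf0 : ∀ v : Site 2, v ∉ B → fderiv ℝ φ (meshPoint δ v) = 0 := by
    intro v hv
    apply fderiv_of_notMem_tsupport
    intro hmem'
    exact hv (hmem v 0 (by simp) (by rwa [add_zero]))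
  have hsum0 : pair0 G φ δ = ∑ v ∈ B, A0 G v * dbar φ (meshPoint δ v) := by
    refine finsum_eq_sum_of_support_subset _ fun v hv => ?_
    by_contra hvB
    exact hv (by simp [dbar, hdf0 v hvB])
  have hsum2 : pair2 G φ δ = ∑ v ∈ B, A2 G v * del φ (meshPoint δ v) := by
    refine finsum_eq_sum_of_support_subset _ fun v hv => ?_
    by_contra hvB
    exact hv (by simp [del, hdf0 v hvB])
  -- linearisation: `η(1+i)(pair0 − i pair2) = Σ_v (L v − E v)`
  have hX : (η : ℂ) * (1 + I) * (pair0 G φ δ - I * pair2 G φ δ) = ∑ v ∈ B, (L v - E v) := by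
    rw [Finset.sum_sub_distrib, hgreen, sub_zero, hsum0, hsum2, Finset.mul_sum,
      ← Finset.sum_sub_distrib, Finset.mul_sum]
    exact Finset.sum_congr rfl fun v _ => by
      rw [hL]; exact (corner_linearisation_eq G φ v _ _).symm
  -- norm estimate
  have hrem : ‖(η : ℂ) * (1 + I) * (pair0 G φ δ - I * pair2 G φ δ)‖ ≤
      (B).card * (8 * M * M₂ * η ^ 2) := by
    rw [hX]
    refine (norm_sum_le _ _).trans ?_
    have : ∀ v ∈ B, ‖L v - E v‖ ≤ 8 * M * M₂ * η ^ 2 := by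
      intro v _
      rw [norm_sub_rev, hE, hL]
      exact norm_corner_taylor_le η hM (hT _) (hG _) (hG _) (hG _) (hG _)
    refine (Finset.sum_le_sum this).trans ?_
    rw [Finset.sum_const, nsmul_eq_mul]
  have hlow : η * ‖pair0 G φ δ - I * pair2 G φ δ‖ ≤
      ‖(η : ℂ) * (1 + I) * (pair0 G φ δ - I * pair2 G φ δ)‖ := by
    rw [norm_mul, norm_mul, norm_real, Real.norm_eq_abs, abs_of_pos hηpos]
    have h1I : (1 : ℝ) ≤ ‖(1 : ℂ) + I‖ := by
      have := abs_re_le_norm ((1 : ℂ) + I)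
      simpa using this
    calc η * ‖pair0 G φ δ - I * pair2 G φ δ‖ = η * 1 * ‖pair0 G φ δ - I * pair2 G φ δ‖ := by ring
      _ ≤ η * ‖(1 : ℂ) + I‖ * ‖pair0 G φ δ - I * pair2 G φ δ‖ := by gcongr
  -- conclusion
  have hfin : ‖pair0 G φ δ - I * pair2 G φ δ‖ ≤ (B).card * (8 * M * M₂ * η) :=
    le_of_mul_le_mul_left ((hlow.trans hrem).trans_eq (by ring)) hηpos
  rw [le_div_iff₀ hδ]
  calc ‖pair0 G φ δ - I * pair2 G φ δ‖ * δ ≤ (B).card * (8 * M * M₂ * η) * δ := by gcongr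
    _ = ((B).card * δ ^ 2) * (4 * M * M₂) := by rw [hη]; ring
    _ ≤ (2 * R + 5) ^ 2 * (4 * M * M₂) := by gcongr
    _ = 4 * (2 * R + 5) ^ 2 * M₂ * M := by ring

end

end Summit.CriticalPhenomena.CardyFormulaZ2.Cruxes.CoherentMorera.FinitaryGreenPairing
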